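import Summits.AtomisticToContinuum.Crystallization.Theorems.FreeSplittingCertificatesStrictSplittingRuleP1FarCellFormB

/-!
# `StrictSplittingRule` (stmt-AtomisticToContinuum-12560): THE (B∃) TAIL LEMMA — the per-cell readout + defect budget holds IN THE KERNEL for every cell `≥ 44a` from the base under the exact-rule allocation; hypothesis (B∃) of the endpoint becomes FINITE (P1 interpolant object, part 90)

Route `FreeSplittingCertificates`, crux r3 `StrictSplittingRule` (H12⋆ = `stub_coreJointCoercive`), unit b2b-freesplit-B gen 38.
VALUE = a kernel theorem replacing an external certificate (HOME HANDOFF gen 36: "the only further seat-sized kernel item is a (B∃) TAIL";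
CERT §31 (c) `celltail.py`).  Hypothesis (B∃) of `coreJointCoercive_cell_of_certificates₉` (part 83) asks, for SOME allocation tables `θ, θv`
of the readout legs to the cells around them, the per-cell budget `Σ_e θ_T(e)·w_e·|δ_eᵀG|² + Σ_e θv_T(e)·wv_e·|δ_eᵀG|² + defect_T(G) ≤
κ(5/48)|G|²_F·∫_Tχ²s⁻³` for EVERY cell `T` — an infinite family certified outside the kernel (cellval.py window + celltail.py tail).  Here it is
PROVED, for every cell all of whose vertices are `≥ 44a` from `y_p` and ANY base `p`, for the EXACT-RULE allocation `θ = θv = p1ThetaX` (part 85;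
rule v31 of the certificate far out), uniformly on the `HcpFamilyMin` box: legs ↦ vertex pairs (`finsum_eq_sum_pairs`), each pair's load
`≤ J_T·p1LoadCoef` (part 87), the class form `≤ (31/200)|G|²_F` column by column (parts 88/89), the exact radial defect `≤ 0.0041·|G|²_F·J_T` (part
85); `31/200 + 0.00407 ≤ κ·5/48 = 0.16083`.  Consequence **`coreJointCoercive_cell_of_certificates₁₀`**: part 83's endpoint with (B∃) asked only for the cells
with a vertex within `44a` of the base (all inside the explicit FINITE index box `Icc(p.1 ± 54) × Icc(p.2.1 ± 70) × Icc(p.2.2 ± 52)`), for tables that follow the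
exact rule on the cells `≥ 44a` away.
* `fortyfour_le_of_not_mem_siteBox44`, `p1CellBox44`, `far_of_not_mem_cellBox44`;
* `finsum_eq_sum_pairs`, `pair_term_le`, **`farCell_budget`**, `finsum_p1ThetaX_eq_one` (the exact rule is an allocation), **`coreJointCoercive_cell_of_certificates₁₀`**.
Outside the kernel (B∃) is now a finite statement (the cells with a vertex within `44a` of the base; certified by cellval rc ≤ 12.3a + celltail on
`[11.9a, 45a]`, HOME CERT §31); the tail engine beyond `45a` leaves the trust base.  NOT a proof of H12⋆ (finite (B∃), finite (S), (TAB), (PAY),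
(NC∃) remain certificate-tier hypotheses), NOT summit progress.  [folklore]
-/

noncomputable section

open Set Function Metric MeasureTheory Filter Topology
open scoped BigOperators NNReal ENNReal Classical

namespace Summit.AtomisticToContinuum.Crystallization.Theorems.StrictSplittingRuleBirth

open Literature.MathematicalPhysics.StatisticalMechanics
open Summit.AtomisticToContinuum.Crystallization.Theorems.PalmUnimodularRigidity.LayeredLawsSelectHcp

/-! ## Outside an explicit index box every site is at least `44a` away -/

/-- **The `44a` site box**: every site `q` outside `Icc(p.1 ± 53) × Icc(p.2.1 ± 69) × Icc(p.2.2 ± 51)` satisfies `‖y_q − y_p‖ ≥ 44a`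
(`h ≥ 0.81619a`; one far coordinate, as in parts 75/83). -/
theorem fortyfour_le_of_not_mem_siteBox44 {a h : ℝ} (ha : 0 < a) (hlo : 81619 / 100000 * a ≤ h) (p q : ℤ × ℤ × ℤ)
    (hq : q ∉ Finset.Icc (p.1 - 53) (p.1 + 53) ×ˢ (Finset.Icc (p.2.1 - 69) (p.2.1 + 69) ×ˢ Finset.Icc (p.2.2 - 51) (p.2.2 + 51))) :
    44 * a ≤ ‖hcpSite a h q - hcpSite a h p‖ := by
  have hh : 0 < h := lt_of_lt_of_le (by positivity) hlo
  have hout : 53 < |q.1 - p.1| ∨ 69 < |q.2.1 - p.2.1| ∨ 51 < |q.2.2 - p.2.2| := by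
    by_contra hc
    simp only [not_or, not_lt] at hc
    obtain ⟨h1, h2, h3⟩ := hc
    apply hq
    simp only [Finset.mem_product, Finset.mem_Icc]
    rw [abs_le] at h1 h2 h3
    refine ⟨⟨by linarith [h1.1], by linarith [h1.2]⟩, ⟨by linarith [h2.1], by linarith [h2.2]⟩, ⟨by linarith [h3.1], by linarith [h3.2]⟩⟩
  have hlab : ∀ z : ℤ, (haggLabel alternatingHagg z : ℝ) = 0 ∨ (haggLabel alternatingHagg z : ℝ) = 1 := by
    intro z
    rcases Int.even_or_odd z with hz | hz
    · left; rw [haggLabel_alternating_of_even hz]; simp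
    · right; rw [haggLabel_alternating_of_odd hz]; simp
  have h173 : (173 / 100 : ℝ) ≤ √3 := by
    rw [show (173 / 100 : ℝ) = √((173 / 100) ^ 2) by rw [Real.sqrt_sq (by norm_num)]]
    exact Real.sqrt_le_sqrt (by norm_num)
  have hcoord : ∀ j : Fin 3, |hcpSite a h q j - hcpSite a h p j| ≤ ‖hcpSite a h q - hcpSite a h p‖ := by
    intro j
    have := PiLp.norm_apply_le (hcpSite a h q - hcpSite a h p) j
    rwa [PiLp.sub_apply, Real.norm_eq_abs] at this
  rcases hout with hk | hrest
  · refine le_trans ?_ (hcoord 2)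
    rw [hcpSite_apply_two, hcpSite_apply_two]
    have hk' : (54 : ℝ) ≤ |((q.1 : ℝ) - p.1)| := by
      have : (54 : ℤ) ≤ |q.1 - p.1| := hk
      exact_mod_cast this
    rw [show (q.1 : ℝ) * h - (p.1 : ℝ) * h = ((q.1 : ℝ) - p.1) * h by ring, abs_mul, abs_of_pos hh]
    nlinarith
  · by_cases hJ' : 51 < |q.2.2 - p.2.2|
    · refine le_trans ?_ (hcoord 1)
      rw [hcpSite_apply_one, hcpSite_apply_one]
      have hJr : (52 : ℝ) ≤ |((q.2.2 : ℝ) - p.2.2)| := by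
        have : (52 : ℤ) ≤ |q.2.2 - p.2.2| := hJ'
        exact_mod_cast this
      have e : a * √3 / 2 * ((q.2.2 : ℝ) + haggLabel alternatingHagg q.1 / 3) - a * √3 / 2 * ((p.2.2 : ℝ) + haggLabel alternatingHagg p.1 / 3) =
          a * √3 / 2 * (((q.2.2 : ℝ) - p.2.2) + ((haggLabel alternatingHagg q.1 : ℝ) - haggLabel alternatingHagg p.1) / 3) := by ring
      rw [e, abs_mul, abs_of_pos (by positivity : (0 : ℝ) < a * √3 / 2)]
      have hin : (155 / 3 : ℝ) ≤ |((q.2.2 : ℝ) - p.2.2) + ((haggLabel alternatingHagg q.1 : ℝ) - haggLabel alternatingHagg p.1) / 3| := by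
        rcases hlab q.1 with l1 | l1 <;> rcases hlab p.1 with l2 | l2 <;>
          rw [l1, l2, le_abs] <;> rcases le_or_gt 0 ((q.2.2 : ℝ) - p.2.2) with hs | hs <;>
          first
          | (left; rw [abs_of_nonneg hs] at hJr; linarith)
          | (right; rw [abs_of_neg hs] at hJr; linarith)
      have hm := mul_le_mul_of_nonneg_right hin (by positivity : (0 : ℝ) ≤ a * √3 / 2)
      nlinarith [hm, h173, ha]
    · have hJle : |q.2.2 - p.2.2| ≤ 51 := not_lt.1 hJ'
      have hI : 69 < |q.2.1 - p.2.1| := by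
        rcases hrest with hI | hJ
        · exact hI
        · exact absurd hJ hJ'
      refine le_trans ?_ (hcoord 0)
      rw [hcpSite_apply_zero, hcpSite_apply_zero]
      have hIr : (70 : ℝ) ≤ |((q.2.1 : ℝ) - p.2.1)| := by
        have : (70 : ℤ) ≤ |q.2.1 - p.2.1| := hI
        exact_mod_cast this
      have hJr : |((q.2.2 : ℝ) - p.2.2)| ≤ 51 := by exact_mod_cast hJle
      have e : a * ((q.2.1 : ℝ) + (q.2.2 : ℝ) / 2 + haggLabel alternatingHagg q.1 / 2) -
          a * ((p.2.1 : ℝ) + (p.2.2 : ℝ) / 2 + haggLabel alternatingHagg p.1 / 2) =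
          a * (((q.2.1 : ℝ) - p.2.1) + ((q.2.2 : ℝ) - p.2.2) / 2 +
            ((haggLabel alternatingHagg q.1 : ℝ) - haggLabel alternatingHagg p.1) / 2) := by ring
      rw [e, abs_mul, abs_of_pos ha]
      have hin : (44 : ℝ) ≤ |((q.2.1 : ℝ) - p.2.1) + ((q.2.2 : ℝ) - p.2.2) / 2 +
          ((haggLabel alternatingHagg q.1 : ℝ) - haggLabel alternatingHagg p.1) / 2| := by
        rw [abs_le] at hJr
        obtain ⟨hJ1, hJ2⟩ := hJr
        rcases hlab q.1 with l1 | l1 <;> rcases hlab p.1 with l2 | l2 <;>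
          rw [l1, l2, le_abs] <;> rcases le_or_gt 0 ((q.2.1 : ℝ) - p.2.1) with hs | hs <;>
          first
          | (left; rw [abs_of_nonneg hs] at hIr; linarith)
          | (right; rw [abs_of_neg hs] at hIr; linarith)
      have hm := mul_le_mul_of_nonneg_right hin ha.le
      linarith

/-- **The `44a` CELL box**: cube indices `Icc(p.1 ± 54) × Icc(p.2.1 ± 70) × Icc(p.2.2 ± 52)`. [folklore] -/
def p1CellBox44 (p : ℤ × ℤ × ℤ) : Finset (ℤ × ℤ × ℤ) :=
  Finset.Icc (p.1 - 54) (p.1 + 54) ×ˢ (Finset.Icc (p.2.1 - 70) (p.2.1 + 70) ×ˢ Finset.Icc (p.2.2 - 52) (p.2.2 + 52))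

/-- **Every vertex of a cell outside the `44a` cell box is `≥ 44a` from `y_p`** (vertex offsets lie in `{0,1}³`). -/
theorem far_of_not_mem_cellBox44 {a h : ℝ} (ha : 0 < a) (hlo : 81619 / 100000 * a ≤ h) (p : ℤ × ℤ × ℤ) (T : (ℤ × ℤ × ℤ) × Fin 6)
    (hT : T.1 ∉ p1CellBox44 p) (b : Bool) (m : Fin 4) : 44 * a ≤ ‖hcpSite a h (T.1 + p1VertOff b T.2 m) - hcpSite a h p‖ := by
  refine fortyfour_le_of_not_mem_siteBox44 ha hlo p _ fun hmem => hT ?_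
  have ho := p1VertOff_mem_p1Corners b T.2 m
  have hco : ∀ o ∈ p1Corners, (0 ≤ o.1 ∧ o.1 ≤ 1) ∧ (0 ≤ o.2.1 ∧ o.2.1 ≤ 1) ∧ (0 ≤ o.2.2 ∧ o.2.2 ≤ 1) := by decide
  obtain ⟨h1, h2, h3⟩ := hco _ ho
  simp only [p1CellBox44, Finset.mem_product, Finset.mem_Icc] at hmem ⊢
  simp only [Prod.fst_add, Prod.snd_add] at hmem
  omega

/-! ## Legs ↦ vertex pairs -/

/-- **A sum over legs supported on the edges of a cell is the sum over its ordered vertex pairs** (the edge map is injective). -/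
theorem finsum_eq_sum_pairs (T : (ℤ × ℤ × ℤ) × Fin 6) (f : (ℤ × ℤ × ℤ) × (ℤ × ℤ × ℤ) → ℝ) (hf : ∀ e, e ∉ p1EdgeSet T → f e = 0) :
    ∑ᶠ e, f e = ∑ m : Fin 4, ∑ m' : Fin 4,
      f (T.1 + p1VertOff (p1Par T.1) T.2 m, p1VertOff (p1Par T.1) T.2 m' - p1VertOff (p1Par T.1) T.2 m) := by
  have hsupp : (Function.support f) ⊆ ↑(p1EdgeSet T) := by
    intro e he
    rw [Function.mem_support] at he
    by_contra hne
    exact he (hf e hne)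
  rw [finsum_eq_sum_of_support_subset _ hsupp, p1EdgeSet, Finset.sum_image, Fintype.sum_prod_type]
  rintro ⟨m₁, m₁'⟩ - ⟨m₂, m₂'⟩ - heq
  simp only [Prod.mk.injEq] at heq
  obtain ⟨h1, h2⟩ := heq
  have hm : m₁ = m₂ := p1VertOff_injective _ _ (add_left_cancel h1)
  subst hm
  have hm' : m₁' = m₂' := p1VertOff_injective (p1Par T.1) T.2 (sub_left_injective h2)
  rw [hm']

/-! ## The per-cell budget of a far cell -/

/-- One vertex pair's term of the budget against `J_T · p1LoadCoef · Σ_k ⟪δ, G_{·k}⟫²` (part 87 times the nonnegative dyad, edge vector of part 88). -/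
theorem pair_term_le {a h : ℝ} (ha : 0 < a) (hh : 0 < h) (hfam : HcpFamilyMin a h) (φ : Finset ((ℤ × ℤ × ℤ) × (ℤ × ℤ × ℤ)))
    (p : ℤ × ℤ × ℤ) (T : (ℤ × ℤ × ℤ) × Fin 6)
    (hfar : ∀ m : Fin 4, 44 * a ≤ ‖hcpSite a h (T.1 + p1VertOff (p1Par T.1) T.2 m) - hcpSite a h p‖)
    (G : Fin 3 → Fin 3 → ℝ) (m m' : Fin 4) :
    let e : (ℤ × ℤ × ℤ) × (ℤ × ℤ × ℤ) := (T.1 + p1VertOff (p1Par T.1) T.2 m, p1VertOff (p1Par T.1) T.2 m' - p1VertOff (p1Par T.1) T.2 m)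
    p1ThetaX a h p e T * p1FarW a h φ p e *
        fpSq (fun k => (hcpSite a h (e.1 + e.2) 0 - hcpSite a h e.1 0) * G 0 k +
          (hcpSite a h (e.1 + e.2) 1 - hcpSite a h e.1 1) * G 1 k + (hcpSite a h (e.1 + e.2) 2 - hcpSite a h e.1 2) * G 2 k) +
      p1ThetaX a h p e T * p1RouteW a h φ p e *
        fpSq (fun k => (hcpSite a h (e.1 + e.2) 0 - hcpSite a h e.1 0) * G 0 k +
          (hcpSite a h (e.1 + e.2) 1 - hcpSite a h e.1 1) * G 1 k + (hcpSite a h (e.1 + e.2) 2 - hcpSite a h e.1 2) * G 2 k) ≤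
      p1CellJ a h p T * (p1LoadCoef a h (p1Par T.1) T.2 m m' *
        ((p1EdgeVec a h (p1Par T.1) T.2 m m' 0 * G 0 0 + p1EdgeVec a h (p1Par T.1) T.2 m m' 1 * G 1 0 + p1EdgeVec a h (p1Par T.1) T.2 m m' 2 * G 2 0) ^ 2 +
         (p1EdgeVec a h (p1Par T.1) T.2 m m' 0 * G 0 1 + p1EdgeVec a h (p1Par T.1) T.2 m m' 1 * G 1 1 + p1EdgeVec a h (p1Par T.1) T.2 m m' 2 * G 2 1) ^ 2 +
         (p1EdgeVec a h (p1Par T.1) T.2 m m' 0 * G 0 2 + p1EdgeVec a h (p1Par T.1) T.2 m m' 1 * G 1 2 + p1EdgeVec a h (p1Par T.1) T.2 m m' 2 * G 2 2) ^ 2)) := by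
  intro e
  have hx : e.1 + e.2 = T.1 + p1VertOff (p1Par T.1) T.2 m' := by
    show T.1 + p1VertOff (p1Par T.1) T.2 m + (p1VertOff (p1Par T.1) T.2 m' - p1VertOff (p1Par T.1) T.2 m) = _
    abel
  have he1 : e.1 = T.1 + p1VertOff (p1Par T.1) T.2 m := rfl
  have hvec : ∀ j : Fin 3, hcpSite a h (e.1 + e.2) j - hcpSite a h e.1 j = p1EdgeVec a h (p1Par T.1) T.2 m m' j := by
    intro j; rw [hx, he1]; exact edgeVec_eq a h T rfl m m' j
  have hF : fpSq (fun k => (hcpSite a h (e.1 + e.2) 0 - hcpSite a h e.1 0) * G 0 k +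
      (hcpSite a h (e.1 + e.2) 1 - hcpSite a h e.1 1) * G 1 k + (hcpSite a h (e.1 + e.2) 2 - hcpSite a h e.1 2) * G 2 k) =
      (p1EdgeVec a h (p1Par T.1) T.2 m m' 0 * G 0 0 + p1EdgeVec a h (p1Par T.1) T.2 m m' 1 * G 1 0 + p1EdgeVec a h (p1Par T.1) T.2 m m' 2 * G 2 0) ^ 2 +
      (p1EdgeVec a h (p1Par T.1) T.2 m m' 0 * G 0 1 + p1EdgeVec a h (p1Par T.1) T.2 m m' 1 * G 1 1 + p1EdgeVec a h (p1Par T.1) T.2 m m' 2 * G 2 1) ^ 2 +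
      (p1EdgeVec a h (p1Par T.1) T.2 m m' 0 * G 0 2 + p1EdgeVec a h (p1Par T.1) T.2 m m' 1 * G 1 2 + p1EdgeVec a h (p1Par T.1) T.2 m m' 2 * G 2 2) ^ 2 := by
    simp only [fpSq, hvec]
  rw [hF, ← add_mul]
  have hF0 : 0 ≤ (p1EdgeVec a h (p1Par T.1) T.2 m m' 0 * G 0 0 + p1EdgeVec a h (p1Par T.1) T.2 m m' 1 * G 1 0 + p1EdgeVec a h (p1Par T.1) T.2 m m' 2 * G 2 0) ^ 2 +
      (p1EdgeVec a h (p1Par T.1) T.2 m m' 0 * G 0 1 + p1EdgeVec a h (p1Par T.1) T.2 m m' 1 * G 1 1 + p1EdgeVec a h (p1Par T.1) T.2 m m' 2 * G 2 1) ^ 2 +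
      (p1EdgeVec a h (p1Par T.1) T.2 m m' 0 * G 0 2 + p1EdgeVec a h (p1Par T.1) T.2 m m' 1 * G 1 2 + p1EdgeVec a h (p1Par T.1) T.2 m m' 2 * G 2 2) ^ 2 := by
    positivity
  have key := pair_load_le ha hh hfam φ p T (b := p1Par T.1) rfl m m' (hfar m) (hfar m')
  rw [mul_add] at key
  rw [← mul_assoc]
  exact mul_le_mul_of_nonneg_right key hF0

/-- **THE (B∃) TAIL LEMMA (per-cell budget of every far cell, in the kernel).**  For the hcp family minimiser `(a,h)`, ANY base site `p`,
every cell `T` whose four vertices are `≥ 44a` from `y_p`, and every `G`: the body of hypothesis (B∃) of `coreJointCoercive_cell_of_certificates₉`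
holds with the exact-rule allocation `θ = θv = p1ThetaX` — readout load of the pinned far shares + exact radial defect `≤ κ(5/48)|G|²_F·J_T`.
NOT a proof of H12⋆, NOT summit progress. -/
theorem farCell_budget {a h : ℝ} (ha : 0 < a) (hh : 0 < h) (hfam : HcpFamilyMin a h) (p : ℤ × ℤ × ℤ) (T : (ℤ × ℤ × ℤ) × Fin 6)
    (hfar : ∀ m : Fin 4, 44 * a ≤ ‖hcpSite a h (T.1 + p1VertOff (p1Par T.1) T.2 m) - hcpSite a h p‖) (G : Fin 3 → Fin 3 → ℝ) :
      (∑ᶠ e : (ℤ × ℤ × ℤ) × (ℤ × ℤ × ℤ), p1ThetaX a h p e T * p1FarW a h (p1Phi0 p) p e *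
          fpSq (fun k => (hcpSite a h (e.1 + e.2) 0 - hcpSite a h e.1 0) * G 0 k +
            (hcpSite a h (e.1 + e.2) 1 - hcpSite a h e.1 1) * G 1 k + (hcpSite a h (e.1 + e.2) 2 - hcpSite a h e.1 2) * G 2 k)) +
      (∑ᶠ e : (ℤ × ℤ × ℤ) × (ℤ × ℤ × ℤ), p1ThetaX a h p e T *
          (∑ i : Fin 3, (2 / 3) * ((if e.2 = p1RouteOff e.1 i then p1FarWv a h (p1Phi0 p) p e.1 else 0) +
            (if p1RouteOff (e.1 - (p1SV - e.2)) i = p1SV - e.2 then p1FarWv a h (p1Phi0 p) p (e.1 - (p1SV - e.2)) else 0))) *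
          fpSq (fun k => (hcpSite a h (e.1 + e.2) 0 - hcpSite a h e.1 0) * G 0 k +
            (hcpSite a h (e.1 + e.2) 1 - hcpSite a h e.1 1) * G 1 k + (hcpSite a h (e.1 + e.2) 2 - hcpSite a h e.1 2) * G 2 k)) +
      p1CellDefectG a h (fun y k l => (193 / 125) * ((7 * (5 / 4 : ℝ) + 3 / 4) / 4) * fpChi ((81 / 20 * a) ^ 2) ((27 / 5 * a) ^ 2) (y - fun k => hcpSite a h p k) ^ 2 *
          (fpSq (y - fun k => hcpSite a h p k))⁻¹ ^ 5 * ((y - fun k => hcpSite a h p k) k * (y - fun k => hcpSite a h p k) l)) T G ≤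
      (193 / 125) * ((5 / 2 * (1 / 24 * fpSymSq G) + 5 / 2 * (1 / 24 * (fpFrob G - fpSymSq G))) *
        ∫ y in p1RealCell a h T, fpChi ((81 / 20 * a) ^ 2) ((27 / 5 * a) ^ 2) (y - fun k => hcpSite a h p k) ^ 2 * (fpSq (y - fun k => hcpSite a h p k))⁻¹ ^ 3) := by
  -- the box
  obtain ⟨hA, hH⟩ := hcpFamilyMin_enclosure ha hh hfam
  rw [abs_sub_le_iff] at hA hH
  obtain ⟨hA1, hA2⟩ := hA
  obtain ⟨hH1, hH2⟩ := hH
  obtain ⟨hρ1, hρ2⟩ := ratioBox_of_hcpFamilyMin ha hh hfam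
  have ha1 : 97119 / 100000 ≤ a := by linarith
  have hh1 : 79284 / 100000 ≤ h := by linarith
  have hh2 : h ≤ 79304 / 100000 := by linarith
  -- Step 1: legs ↦ vertex pairs
  rw [finsum_eq_sum_pairs T _ (fun e he => by rw [p1ThetaX_eq_zero he, zero_mul, zero_mul]),
    finsum_eq_sum_pairs T _ (fun e he => by rw [p1ThetaX_eq_zero he, zero_mul, zero_mul]), ← Finset.sum_add_distrib]
  simp only [← Finset.sum_add_distrib]
  -- Step 2: each pair against `J_T · p1LoadCoef · Σ_k ⟪δ, G_k⟫²`, summed: the class form column by column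
  have hpairs := fun m m' => pair_term_le ha hh hfam (p1Phi0 p) p T hfar G m m'
  have hsum : ∑ m : Fin 4, ∑ m' : Fin 4, p1CellJ a h p T * (p1LoadCoef a h (p1Par T.1) T.2 m m' *
        ((p1EdgeVec a h (p1Par T.1) T.2 m m' 0 * G 0 0 + p1EdgeVec a h (p1Par T.1) T.2 m m' 1 * G 1 0 + p1EdgeVec a h (p1Par T.1) T.2 m m' 2 * G 2 0) ^ 2 +
         (p1EdgeVec a h (p1Par T.1) T.2 m m' 0 * G 0 1 + p1EdgeVec a h (p1Par T.1) T.2 m m' 1 * G 1 1 + p1EdgeVec a h (p1Par T.1) T.2 m m' 2 * G 2 1) ^ 2 +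
         (p1EdgeVec a h (p1Par T.1) T.2 m m' 0 * G 0 2 + p1EdgeVec a h (p1Par T.1) T.2 m m' 1 * G 1 2 + p1EdgeVec a h (p1Par T.1) T.2 m m' 2 * G 2 2) ^ 2)) =
      p1CellJ a h p T * (p1ClassForm a h (p1Par T.1) T.2 (fun j => G j 0) + p1ClassForm a h (p1Par T.1) T.2 (fun j => G j 1) +
        p1ClassForm a h (p1Par T.1) T.2 (fun j => G j 2)) := by
    simp only [p1ClassForm, mul_add, Finset.sum_add_distrib, Finset.mul_sum]
  have hread : ∑ m : Fin 4, ∑ m' : Fin 4, p1CellJ a h p T * (p1LoadCoef a h (p1Par T.1) T.2 m m' *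
        ((p1EdgeVec a h (p1Par T.1) T.2 m m' 0 * G 0 0 + p1EdgeVec a h (p1Par T.1) T.2 m m' 1 * G 1 0 + p1EdgeVec a h (p1Par T.1) T.2 m m' 2 * G 2 0) ^ 2 +
         (p1EdgeVec a h (p1Par T.1) T.2 m m' 0 * G 0 1 + p1EdgeVec a h (p1Par T.1) T.2 m m' 1 * G 1 1 + p1EdgeVec a h (p1Par T.1) T.2 m m' 2 * G 2 1) ^ 2 +
         (p1EdgeVec a h (p1Par T.1) T.2 m m' 0 * G 0 2 + p1EdgeVec a h (p1Par T.1) T.2 m m' 1 * G 1 2 + p1EdgeVec a h (p1Par T.1) T.2 m m' 2 * G 2 2) ^ 2)) ≤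
      p1CellJ a h p T * (31 / 200 * fpFrob G) := by
    rw [hsum]
    refine mul_le_mul_of_nonneg_left ?_ (p1CellJ_nonneg a h p T)
    have c0 := classForm_le ha1 hh1 hh2 (p1Par T.1) T.2 (fun j => G j 0)
    have c1 := classForm_le ha1 hh1 hh2 (p1Par T.1) T.2 (fun j => G j 1)
    have c2 := classForm_le ha1 hh1 hh2 (p1Par T.1) T.2 (fun j => G j 2)
    simp only [fpFrob]
    linarith
  -- Step 3: the exact radial defect of a far cell (part 85)
  have hdef := p1CellDefectG_far_le ha hh (by linarith) (by norm_num : (0 : ℝ) ≤ (193 / 125) * ((7 * (5 / 4 : ℝ) + 3 / 4) / 4))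
    (by norm_num : (7 : ℝ) ≤ 44) p T hfar G
  -- Step 4: collect; all atoms opaque from here on
  have hJ0 := p1CellJ_nonneg a h p T
  have hFr0 : 0 ≤ fpFrob G := by unfold fpFrob; positivity
  have hρ : (4 * a ^ 2 / 3 + h ^ 2) / ((44 - 3 / 2) ^ 2 * a ^ 2) ≤ 111 / 100000 := by
    rw [div_le_iff₀ (by positivity)]
    have : h ^ 2 ≤ (81657 / 100000 * a) ^ 2 := pow_le_pow_left₀ hh.le hρ2 2
    nlinarith
  have hJint : (∫ y in p1RealCell a h T, fpChi ((81 / 20 * a) ^ 2) ((27 / 5 * a) ^ 2) (y - fun k => hcpSite a h p k) ^ 2 *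
      (fpSq (y - fun k => hcpSite a h p k))⁻¹ ^ 3) = p1CellJ a h p T := rfl
  rw [hJint]
  refine le_trans (add_le_add (le_trans (Finset.sum_le_sum fun m _ => Finset.sum_le_sum fun m' _ => hpairs m m') hread) hdef) ?_
  have hprod : 0 ≤ fpFrob G * p1CellJ a h p T := mul_nonneg hFr0 hJ0
  revert hprod
  generalize p1CellJ a h p T = J
  generalize fpFrob G = F
  generalize fpSymSq G = S
  intro hprod
  have e1 : J * (31 / 200 * F) + 193 / 125 * ((7 * (5 / 4 : ℝ) + 3 / 4) / 4) * (4 * a ^ 2 / 3 + h ^ 2) / ((44 - 3 / 2) ^ 2 * a ^ 2) * F * J =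
      (31 / 200 + 193 / 125 * ((7 * (5 / 4 : ℝ) + 3 / 4) / 4) * ((4 * a ^ 2 / 3 + h ^ 2) / ((44 - 3 / 2) ^ 2 * a ^ 2))) * (F * J) := by ring
  have e2 : (193 / 125 : ℝ) * ((5 / 2 * (1 / 24 * S) + 5 / 2 * (1 / 24 * (F - S))) * J) = 193 / 125 * (5 / 48) * (F * J) := by ring
  rw [e1, e2]
  revert hρ
  generalize (4 * a ^ 2 / 3 + h ^ 2) / ((44 - 3 / 2) ^ 2 * a ^ 2) = ρ
  intro hρ
  nlinarith [mul_le_mul_of_nonneg_right hρ hprod]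

/-- **The exact rule IS an allocation**: its row sums are `1` on every leg of positive capacity (the constraint of (B∃_fin) below is satisfiable by it). -/
theorem finsum_p1ThetaX_eq_one {a h : ℝ} (p : ℤ × ℤ × ℤ) (e : (ℤ × ℤ × ℤ) × (ℤ × ℤ × ℤ)) (hcap : 0 < p1CapJ a h p e) :
    ∑ᶠ T, p1ThetaX a h p e T = 1 := by
  have hsupp : (Function.support fun T => p1ThetaX a h p e T) ⊆ ↑(p1CellsAt e.1) := fun T hT => by
    rw [Function.mem_support] at hT
    by_contra hne
    exact hT (p1ThetaX_eq_zero fun hE => hne (isEdge_subset e hE))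
  rw [finsum_eq_sum_of_support_subset _ hsupp]
  have hs : ∑ T ∈ p1CellsAt e.1, p1ThetaX a h p e T =
      (∑ T ∈ p1CellsAt e.1, if e ∈ p1EdgeSet T then p1CellJ a h p T else 0) / p1CapJ a h p e := by
    rw [Finset.sum_div]
    refine Finset.sum_congr rfl fun T _ => ?_
    unfold p1ThetaX
    split_ifs <;> simp
  rw [hs, ← p1CapJ_eq_sum, div_self hcap.ne']

/-! ## The endpoint with finite (B∃) -/

/-- **H12⋆ ON THE BOX FROM FIVE CLOSED CERTIFICATE STATEMENTS, (S) AND NOW (B∃) FINITE.**  Part 83's `coreJointCoercive_cell_of_certificates₉`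
with hypothesis (B∃) asked only for the cells with a vertex WITHIN `44a` of `y_p` — all of them in the explicit finite box `p1CellBox44 p` (`Icc(p.1 ± 54) ×
Icc(p.2.1 ± 70) × Icc(p.2.2 ± 52)`, `far_of_not_mem_cellBox44`) — for allocation tables that FOLLOW THE EXACT RULE `θ = θv = p1ThetaX` on the cells whose four
vertices are `≥ 44a` away (rule v31 of the certificate does); every such cell is `farCell_budget`.  The other four hypotheses are verbatim.  NOT a proof of H12⋆ (finite (B∃), finite (S), (TAB),
(PAY), (NC∃) are hypotheses verified outside the kernel), NOT summit progress. -/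
theorem coreJointCoercive_cell_of_certificates₁₀ {a h : ℝ} (ha : 0 < a) (hh : 0 < h) (hfam : HcpFamilyMin a h)
    -- (B∃_fin) THE PER-CELL BUDGET at each representative FOR SOME allocation tables that follow the EXACT RULE on the cells ≥ 44a away, asked only for the FINITELY MANY cells of the 44a cell box with a vertex within 44a
    (hB : ∀ p ∈ ({(0, 0, 0), (1, 0, 0)} : Finset (ℤ × ℤ × ℤ)),
      ∃ θ θv : (ℤ × ℤ × ℤ) × (ℤ × ℤ × ℤ) → (ℤ × ℤ × ℤ) × Fin 6 → ℝ,
        (∀ e T, 0 ≤ θ e T) ∧ (∀ e, (Function.support (θ e)).Finite) ∧ (∀ T, (Function.support fun e => θ e T).Finite) ∧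
        (∀ e, p1FarW a h (p1Phi0 p) p e ≠ 0 → ∑ᶠ T, θ e T = 1) ∧
        (∀ e T, θ e T ≠ 0 → ∃ m m' : Fin 4, e.1 = T.1 + p1VertOff (p1Par T.1) T.2 m ∧
          e.1 + e.2 = T.1 + p1VertOff (p1Par T.1) T.2 m') ∧
        (∀ e T, 0 ≤ θv e T) ∧ (∀ e, (Function.support (θv e)).Finite) ∧ (∀ T, (Function.support fun e => θv e T).Finite) ∧
        (∀ e, (∑ i : Fin 3, (2 / 3) * ((if e.2 = p1RouteOff e.1 i then p1FarWv a h (p1Phi0 p) p e.1 else 0) +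
          (if p1RouteOff (e.1 - (p1SV - e.2)) i = p1SV - e.2 then p1FarWv a h (p1Phi0 p) p (e.1 - (p1SV - e.2)) else 0))) ≠ 0 → ∑ᶠ T, θv e T = 1) ∧
        (∀ e T, θv e T ≠ 0 → ∃ m m' : Fin 4, e.1 = T.1 + p1VertOff (p1Par T.1) T.2 m ∧
          e.1 + e.2 = T.1 + p1VertOff (p1Par T.1) T.2 m') ∧
        (∀ T : (ℤ × ℤ × ℤ) × Fin 6, (∀ m : Fin 4, 44 * a ≤ ‖hcpSite a h (T.1 + p1VertOff (p1Par T.1) T.2 m) - hcpSite a h p‖) →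
          ∀ e, θ e T = p1ThetaX a h p e T ∧ θv e T = p1ThetaX a h p e T) ∧
        ∀ (T : (ℤ × ℤ × ℤ) × Fin 6), T.1 ∈ p1CellBox44 p →
          (∃ m : Fin 4, ‖hcpSite a h (T.1 + p1VertOff (p1Par T.1) T.2 m) - hcpSite a h p‖ < 44 * a) → ∀ (G : Fin 3 → Fin 3 → ℝ),
      (∑ᶠ e : (ℤ × ℤ × ℤ) × (ℤ × ℤ × ℤ), θ e T * p1FarW a h (p1Phi0 p) p e *
          fpSq (fun k => (hcpSite a h (e.1 + e.2) 0 - hcpSite a h e.1 0) * G 0 k +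
            (hcpSite a h (e.1 + e.2) 1 - hcpSite a h e.1 1) * G 1 k + (hcpSite a h (e.1 + e.2) 2 - hcpSite a h e.1 2) * G 2 k)) +
      (∑ᶠ e : (ℤ × ℤ × ℤ) × (ℤ × ℤ × ℤ), θv e T *
          (∑ i : Fin 3, (2 / 3) * ((if e.2 = p1RouteOff e.1 i then p1FarWv a h (p1Phi0 p) p e.1 else 0) +
            (if p1RouteOff (e.1 - (p1SV - e.2)) i = p1SV - e.2 then p1FarWv a h (p1Phi0 p) p (e.1 - (p1SV - e.2)) else 0))) *
          fpSq (fun k => (hcpSite a h (e.1 + e.2) 0 - hcpSite a h e.1 0) * G 0 k +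
            (hcpSite a h (e.1 + e.2) 1 - hcpSite a h e.1 1) * G 1 k + (hcpSite a h (e.1 + e.2) 2 - hcpSite a h e.1 2) * G 2 k)) +
      p1CellDefectG a h (fun y k l => (193 / 125) * ((7 * (5 / 4 : ℝ) + 3 / 4) / 4) * fpChi ((81 / 20 * a) ^ 2) ((27 / 5 * a) ^ 2) (y - fun k => hcpSite a h p k) ^ 2 *
          (fpSq (y - fun k => hcpSite a h p k))⁻¹ ^ 5 * ((y - fun k => hcpSite a h p k) k * (y - fun k => hcpSite a h p k) l)) T G ≤
      (193 / 125) * ((5 / 2 * (1 / 24 * fpSymSq G) + 5 / 2 * (1 / 24 * (fpFrob G - fpSymSq G))) *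
        ∫ y in p1RealCell a h T, fpChi ((81 / 20 * a) ^ 2) ((27 / 5 * a) ^ 2) (y - fun k => hcpSite a h p k) ^ 2 * (fpSq (y - fun k => hcpSite a h p k))⁻¹ ^ 3))
    -- (S) per-site domination off the PINNED reach set at the FINITELY MANY sites of the 20a index box with `‖y_q − y_p‖ < 20a`; (TAB) the PINNED certified tables
    (hS : ∀ p ∈ ({(0, 0, 0), (1, 0, 0)} : Finset (ℤ × ℤ × ℤ)),
      ∀ q ∈ Finset.Icc (p.1 - 26) (p.1 + 26) ×ˢ (Finset.Icc (p.2.1 - 34) (p.2.1 + 34) ×ˢ Finset.Icc (p.2.2 - 23) (p.2.2 + 23)),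
      q ∉ p1QB p → q ≠ p → ‖hcpSite a h q - hcpSite a h p‖ < 20 * a → ∀ z : Fin 3 → ℝ,
      0 ≤ 1 / 2 * (ljSqDeriv (‖hcpSite a h q - hcpSite a h p‖ ^ 2) * fpSq z +
          2 * (1 / 2 * (7 * ((‖hcpSite a h q - hcpSite a h p‖ ^ 2)⁻¹) ^ 8 -
            4 * ((‖hcpSite a h q - hcpSite a h p‖ ^ 2)⁻¹) ^ 5)) * p1NRad a h p (fun _ => z) q ^ 2) +
        p1SiteBare a h (fun y k l => (193 / 125) * ((7 * (5 / 4 : ℝ) + 3 / 4) / 4) * fpChi ((81 / 20 * a) ^ 2) ((27 / 5 * a) ^ 2) (y - fun k => hcpSite a h p k) ^ 2 *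
          (fpSq (y - fun k => hcpSite a h p k))⁻¹ ^ 5 * ((y - fun k => hcpSite a h p k) k * (y - fun k => hcpSite a h p k) l)) (fun _ => z) q -
        p1SiteBare a h (fun y k l => (193 / 125) * ((3 / 4 : ℝ) / 4) * fpChi ((81 / 20 * a) ^ 2) ((27 / 5 * a) ^ 2) (y - fun k => hcpSite a h p k) ^ 2 *
          (fpSq (y - fun k => hcpSite a h p k))⁻¹ ^ 4 * (if k = l then 1 else 0)) (fun _ => z) q)
    (hTab : ∀ p ∈ ({(0, 0, 0), (1, 0, 0)} : Finset (ℤ × ℤ × ℤ)), ∀ q ∈ p1QB p, q ≠ p → ∀ z : Fin 3 → ℝ,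
      (p1LU p q).1 * p1NRad a h p (fun _ => z) q ^ 2 ≤
        p1SiteBare a h (fun y k l => (193 / 125) * ((7 * (5 / 4 : ℝ) + 3 / 4) / 4) * fpChi ((81 / 20 * a) ^ 2) ((27 / 5 * a) ^ 2) (y - fun k => hcpSite a h p k) ^ 2 *
          (fpSq (y - fun k => hcpSite a h p k))⁻¹ ^ 5 * ((y - fun k => hcpSite a h p k) k * (y - fun k => hcpSite a h p k) l)) (fun _ => z) q ∧
      p1SiteBare a h (fun y k l => (193 / 125) * ((3 / 4 : ℝ) / 4) * fpChi ((81 / 20 * a) ^ 2) ((27 / 5 * a) ^ 2) (y - fun k => hcpSite a h p k) ^ 2 *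
          (fpSq (y - fun k => hcpSite a h p k))⁻¹ ^ 4 * (if k = l then 1 else 0)) (fun _ => z) q ≤ (p1LU p q).2 * fpSq z)
    -- (PAY) the far table's column-sum enclosures by the PINNED payments
    (hPAY : ∀ p ∈ ({(0, 0, 0), (1, 0, 0)} : Finset (ℤ × ℤ × ℤ)), ∀ s ∈ p1BondOffsets, (193 / 125) * (2 / 5) / a ^ 4 *
      (∑' q : ℤ × ℤ × ℤ, p1RecTable a h (p1SplitDensity (81 / 20 * a) (27 / 5 * a)) (decide (Even p.1)) (q - p) s) ≤ p1Paym p s)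
    -- (NC∃) THE NEAR CERTIFICATE WITH THE EXACT COLLAR FLUX at both representatives, FOR SOME stencilled decaying finitely supported near tables
    (hNC : ∃ M₁ N : Bool → (ℤ × ℤ × ℤ) → (ℤ × ℤ × ℤ) → (ℤ × ℤ × ℤ) → ℝ, ∃ QT : (ℤ × ℤ × ℤ) → Finset (ℤ × ℤ × ℤ),
      (∀ b d s s', s ∉ p1BondOffsets ∨ s' ∉ p1BondOffsets → M₁ b d s s' = 0 ∧ N b d s s' = 0) ∧
      (∃ C₁ : ℝ, ∀ p q : ℤ × ℤ × ℤ, ∀ s s', |M₁ (decide (Even p.1)) (q - p) s s'| ≤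
        C₁ * ((1 + ‖hcpSite a h q - hcpSite a h p‖)⁻¹) ^ 6 ∧
      |N (decide (Even p.1)) (q - p) s s'| ≤ C₁ * ((1 + ‖hcpSite a h q - hcpSite a h p‖)⁻¹) ^ 6) ∧
      (∀ p ∈ ({(0, 0, 0), (1, 0, 0)} : Finset (ℤ × ℤ × ℤ)), ∀ q : ℤ × ℤ × ℤ, q ∉ QT p → ∀ s s',
      M₁ (decide (Even p.1)) (q - p) s s' = 0 ∧ M₁ (decide (Even q.1)) (p - q) s s' = 0 ∧
      N (decide (Even p.1)) (q - p) s s' = 0 ∧ N (decide (Even q.1)) (p - q) s' s = 0) ∧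
      ∀ p ∈ ({(0, 0, 0), (1, 0, 0)} : Finset (ℤ × ℤ × ℤ)), ∀ V : ℤ × ℤ × ℤ → (Fin 3 → ℝ), V p = 0 →
      (∀ Z : Fin 3 → Fin 3 → ℝ, (∀ j k, Z j k = -Z k j) →
        ∑ q ∈ (if Even p.1 then hcpStarIdx.image (fun d => d + p) else hcpStarIdx.image (fun d => p - d)), ∑ k : Fin 3, V q k * (∑ j : Fin 3, (hcpSite a h q j - hcpSite a h p j) * Z j k) = 0) →
      0 ≤ p1NearForm a h (1 / 3) (1 / 12) (193 / 125) p p1Stencil (p1Beta a h) M₁ N (p1FarW a h (p1Phi0 p) p) p1SV (p1FarWv a h (p1Phi0 p) p) (fun s => -p1Beta a h (decide (Even p.1)) 0 s) (if Even p.1 then hcpStarIdx.image (fun d => d + p) else hcpStarIdx.image (fun d => p - d)) (p1QB p) (QT p) ∅ (p1FarLegs (p1Phi0 p) p) (fun q => (p1LU p q).1) (fun q => (p1LU p q).2) (p1Paym p) (fun _ => 0) (fun _ _ => 0) V -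
        193 / 125 * p1ExactFluxSum a h p V) :
    CoreJointCoercive a h (1 / 3) (1 / 12)     := by
  have hlo : 81619 / 100000 * a ≤ h := (ratioBox_of_hcpFamilyMin ha hh hfam).1
  refine coreJointCoercive_cell_of_certificates₉ ha hh hfam (fun p hp => ?_) hS hTab hPAY hNC
  obtain ⟨θ, θv, h1, h2, h3, h4, h5, h6, h7, h8, h9, h10, hX, hfin⟩ := hB p hp
  refine ⟨θ, θv, h1, h2, h3, h4, h5, h6, h7, h8, h9, h10, fun T G => ?_⟩
  by_cases hfar : ∀ m : Fin 4, 44 * a ≤ ‖hcpSite a h (T.1 + p1VertOff (p1Par T.1) T.2 m) - hcpSite a h p‖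
  swap
  · have hnear : ∃ m : Fin 4, ‖hcpSite a h (T.1 + p1VertOff (p1Par T.1) T.2 m) - hcpSite a h p‖ < 44 * a := by
      by_contra hc
      exact hfar fun m => not_lt.1 fun hm => hc ⟨m, hm⟩
    have hT : T.1 ∈ p1CellBox44 p := by
      by_contra hT
      obtain ⟨m, hm⟩ := hnear
      exact absurd (far_of_not_mem_cellBox44 ha hlo p T hT (p1Par T.1) m) (not_le.2 hm)
    exact hfin T hT hnear G
  · have hX' := hX T hfar
    have hbud := farCell_budget ha hh hfam p T hfar G
    have e1 := finsum_congr (f := fun e : (ℤ × ℤ × ℤ) × (ℤ × ℤ × ℤ) => θ e T * p1FarW a h (p1Phi0 p) p e *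
        fpSq (fun k => (hcpSite a h (e.1 + e.2) 0 - hcpSite a h e.1 0) * G 0 k +
          (hcpSite a h (e.1 + e.2) 1 - hcpSite a h e.1 1) * G 1 k + (hcpSite a h (e.1 + e.2) 2 - hcpSite a h e.1 2) * G 2 k))
      (g := fun e => p1ThetaX a h p e T * p1FarW a h (p1Phi0 p) p e *
        fpSq (fun k => (hcpSite a h (e.1 + e.2) 0 - hcpSite a h e.1 0) * G 0 k +
          (hcpSite a h (e.1 + e.2) 1 - hcpSite a h e.1 1) * G 1 k + (hcpSite a h (e.1 + e.2) 2 - hcpSite a h e.1 2) * G 2 k))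
      (fun e => by rw [(hX' e).1])
    have e2 := finsum_congr (f := fun e : (ℤ × ℤ × ℤ) × (ℤ × ℤ × ℤ) => θv e T *
          (∑ i : Fin 3, (2 / 3) * ((if e.2 = p1RouteOff e.1 i then p1FarWv a h (p1Phi0 p) p e.1 else 0) +
            (if p1RouteOff (e.1 - (p1SV - e.2)) i = p1SV - e.2 then p1FarWv a h (p1Phi0 p) p (e.1 - (p1SV - e.2)) else 0))) *
          fpSq (fun k => (hcpSite a h (e.1 + e.2) 0 - hcpSite a h e.1 0) * G 0 k +
            (hcpSite a h (e.1 + e.2) 1 - hcpSite a h e.1 1) * G 1 k + (hcpSite a h (e.1 + e.2) 2 - hcpSite a h e.1 2) * G 2 k))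
      (g := fun e => p1ThetaX a h p e T *
          (∑ i : Fin 3, (2 / 3) * ((if e.2 = p1RouteOff e.1 i then p1FarWv a h (p1Phi0 p) p e.1 else 0) +
            (if p1RouteOff (e.1 - (p1SV - e.2)) i = p1SV - e.2 then p1FarWv a h (p1Phi0 p) p (e.1 - (p1SV - e.2)) else 0))) *
          fpSq (fun k => (hcpSite a h (e.1 + e.2) 0 - hcpSite a h e.1 0) * G 0 k +
            (hcpSite a h (e.1 + e.2) 1 - hcpSite a h e.1 1) * G 1 k + (hcpSite a h (e.1 + e.2) 2 - hcpSite a h e.1 2) * G 2 k))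
      (fun e => by rw [(hX' e).2])
    rw [e1, e2]
    exact hbud

end Summit.AtomisticToContinuum.Crystallization.Theorems.StrictSplittingRuleBirth

end
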